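import Summits.NavierStokesRegularity.NavierStokesRegularity.Theorems.ThreadingFluxCentreVirialHodgeWeighted
import HarnessLib

/-!
# Hodge slaving, sphere-free — IV: from smooth radial weights to the sharp shell

★ `shell_bochner_ineq`: for `W ∈ C²(ℝ³; ℝ³)` tangential about `x₀` and unthreaded off `x₀`, and `0 < a < b`,
`∫_{a<|y|<b} |W|²/|y|³ ≤ ½ ∫_{a<|y|<b} (div W)²/|y|` — part III with the smooth weights
`κ_n(σ) = S(n(σ − a²))·S(n(b² − σ))/√ψ_{a²}(σ)` (`kapApprox`; `S` = `Real.smoothTransition`, `ψ_α` = `psiReg α`, a smooth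
function equal to `σ` on `[α, ∞)` and `≥ α/2`), which increase to `σ^{-1/2}·1_{(a²,b²)}(σ)` pointwise (eventually constant
at every point, `tendsto_kapApprox`), and dominated convergence on both sides.

Part of the sphere-free proof of HODGE SLAVING FOR `C²` FIELDS (H′) behind ★ T2 `PoloidalTameLiouville` of the
centre-virial card (ns-idea-15 g9; twin `ThreadingFluxCentreVirialDefs`).  Folklore differential geometry / linear algebra,
re-derived in ambient coordinates; information-grade; W1 movement 0; `PoloidalLiouville` (1222), T0, Galdi's problem OPEN;
NS regularity is NOT proved.  `--supports stmt-NavierStokesRegularity-1222 --as helper`.  Filed by ns-wall-eng-4 g6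
(cell ns-wall-extremal).
[cite: KorobkovPileckasRusso2015, Thm 3.6]
-/

-- the summit and its single sub-problem share the name (CONVENTIONS §1)
set_option linter.dupNamespace false

noncomputable section

namespace Summit.NavierStokesRegularity.NavierStokesRegularity.Theorems.PoloidalLiouville.CentreVirial

open Set Function MeasureTheory Filter Topology
open Literature.Analysis.FluidPDE
open Literature.Analysis.FluidPDE.VectorCalculus (divergence)
open Summit.NavierStokesRegularity.NavierStokesRegularity.Theorems.PoloidalLiouville.CentreJet (E3)
open scoped RealInnerProductSpace

namespace Hodge

/-! ### The shell inequality: passing from smooth radial weights to the sharp shell -/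

/-- A smooth function of the squared radius equal to `σ` on `[α, ∞)` and `≥ α/2` everywhere:
`ψ_α(σ) = α/2 + (σ − α/2)·S((2/α)(σ − α/2))`, `S` = `Real.smoothTransition`. -/
def psiReg (α σ : ℝ) : ℝ := α / 2 + (σ - α / 2) * Real.smoothTransition (2 / α * (σ - α / 2))

/-- `ψ_α` is smooth. -/
theorem psiReg_contDiff (α : ℝ) {n : ℕ∞} : ContDiff ℝ n (psiReg α) := by
  unfold psiReg
  exact contDiff_const.add ((contDiff_id.sub contDiff_const).mul
    (Real.smoothTransition.contDiff.comp (contDiff_const.mul (contDiff_id.sub contDiff_const))))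

/-- `ψ_α(σ) = σ` for `σ ≥ α`. -/
theorem psiReg_eq_self {α σ : ℝ} (hα : 0 < α) (hσ : α ≤ σ) : psiReg α σ = σ := by
  unfold psiReg
  have h1 : 1 ≤ 2 / α * (σ - α / 2) := by
    rw [div_mul_eq_mul_div, le_div_iff₀ hα]
    linarith
  rw [Real.smoothTransition.one_of_one_le h1]
  ring

/-- `ψ_α ≥ α/2`. -/
theorem half_le_psiReg {α σ : ℝ} (hα : 0 < α) : α / 2 ≤ psiReg α σ := by
  unfold psiReg
  rcases le_or_gt σ (α / 2) with h | h
  · have h0 : 2 / α * (σ - α / 2) ≤ 0 := mul_nonpos_of_nonneg_of_nonpos (by positivity) (by linarith)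
    rw [Real.smoothTransition.zero_of_nonpos h0]
    linarith
  · have := Real.smoothTransition.nonneg (2 / α * (σ - α / 2))
    nlinarith

/-- `ψ_α > 0`. -/
theorem psiReg_pos {α σ : ℝ} (hα : 0 < α) : 0 < psiReg α σ := lt_of_lt_of_le (by positivity) (half_le_psiReg (σ := σ) hα)

/-- The smooth approximants of the sharp weight `σ^{-1/2}·1_{(α,β)}(σ)`:
`κ_n(σ) = S(n(σ − α)) · S(n(β − σ)) / √ψ_α(σ)`. -/
def kapApprox (α β : ℝ) (n : ℕ) (σ : ℝ) : ℝ :=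
  Real.smoothTransition ((n : ℝ) * (σ - α)) * Real.smoothTransition ((n : ℝ) * (β - σ)) / Real.sqrt (psiReg α σ)

/-- The approximants are `C¹`. -/
theorem kapApprox_contDiff {α β : ℝ} (hα : 0 < α) (n : ℕ) : ContDiff ℝ 1 (kapApprox α β n) := by
  unfold kapApprox
  refine ContDiff.div ?_ ?_ fun σ => (Real.sqrt_pos.2 (psiReg_pos (σ := σ) hα)).ne'
  · exact (Real.smoothTransition.contDiff.comp (contDiff_const.mul (contDiff_id.sub contDiff_const))).mul
      (Real.smoothTransition.contDiff.comp (contDiff_const.mul (contDiff_const.sub contDiff_id)))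
  · exact (psiReg_contDiff α).sqrt fun σ => (psiReg_pos (σ := σ) hα).ne'

/-- `κ_n ≥ 0`. -/
theorem kapApprox_nonneg (α β : ℝ) (n : ℕ) (σ : ℝ) : 0 ≤ kapApprox α β n σ := by
  unfold kapApprox
  exact div_nonneg (mul_nonneg (Real.smoothTransition.nonneg _) (Real.smoothTransition.nonneg _)) (Real.sqrt_nonneg _)

/-- `κ_n = 0` on `(-∞, α]`. -/
theorem kapApprox_eq_zero_of_le {α β : ℝ} (n : ℕ) {σ : ℝ} (h : σ ≤ α) : kapApprox α β n σ = 0 := by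
  unfold kapApprox
  have : (n : ℝ) * (σ - α) ≤ 0 := mul_nonpos_of_nonneg_of_nonpos (Nat.cast_nonneg n) (by linarith)
  rw [Real.smoothTransition.zero_of_nonpos this, zero_mul, zero_div]

/-- `κ_n = 0` on `[β, ∞)`. -/
theorem kapApprox_eq_zero_of_ge {α β : ℝ} (n : ℕ) {σ : ℝ} (h : β ≤ σ) : kapApprox α β n σ = 0 := by
  unfold kapApprox
  have : (n : ℝ) * (β - σ) ≤ 0 := mul_nonpos_of_nonneg_of_nonpos (Nat.cast_nonneg n) (by linarith)
  rw [Real.smoothTransition.zero_of_nonpos this, mul_zero, zero_div]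

/-- Uniform bound `κ_n ≤ (α/2)^{-1/2}`. -/
theorem kapApprox_le {α β : ℝ} (hα : 0 < α) (n : ℕ) (σ : ℝ) : kapApprox α β n σ ≤ (Real.sqrt (α / 2))⁻¹ := by
  unfold kapApprox
  have hs : 0 < Real.sqrt (α / 2) := Real.sqrt_pos.2 (by positivity)
  have hψ : Real.sqrt (α / 2) ≤ Real.sqrt (psiReg α σ) := Real.sqrt_le_sqrt (half_le_psiReg hα)
  have hnum : Real.smoothTransition ((n : ℝ) * (σ - α)) * Real.smoothTransition ((n : ℝ) * (β - σ)) ≤ 1 := by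
    have h1 := Real.smoothTransition.le_one ((n : ℝ) * (σ - α))
    have h2 := Real.smoothTransition.le_one ((n : ℝ) * (β - σ))
    have h3 := Real.smoothTransition.nonneg ((n : ℝ) * (β - σ))
    nlinarith
  have hpos : 0 < Real.sqrt (psiReg α σ) := lt_of_lt_of_le hs hψ
  rw [div_le_iff₀ hpos]
  calc _ ≤ (1 : ℝ) := hnum
    _ = (Real.sqrt (α / 2))⁻¹ * Real.sqrt (α / 2) := by field_simp
    _ ≤ (Real.sqrt (α / 2))⁻¹ * Real.sqrt (psiReg α σ) := mul_le_mul_of_nonneg_left hψ (by positivity)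

/-- Pointwise limit: `κ_n(σ) → σ^{-1/2}` on `(α, β)` (eventually constant) and `= 0` off `(α, β)`. -/
theorem tendsto_kapApprox {α β : ℝ} (hα : 0 < α) (σ : ℝ) :
    Tendsto (fun n : ℕ => kapApprox α β n σ) atTop
      (𝓝 ((Set.Ioo α β).indicator (fun σ => (Real.sqrt σ)⁻¹) σ)) := by
  by_cases hσ : σ ∈ Set.Ioo α β
  · rw [Set.indicator_of_mem hσ]
    obtain ⟨N, hN⟩ := exists_nat_gt (max (1 / (σ - α)) (1 / (β - σ)))
    refine tendsto_const_nhds.congr' (Filter.eventually_atTop.2 ⟨N, fun n hn => ?_⟩)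
    have h1 : 0 < σ - α := by linarith [hσ.1]
    have h2 : 0 < β - σ := by linarith [hσ.2]
    have hn' : (N : ℝ) ≤ n := by exact_mod_cast hn
    have hA : 1 ≤ (n : ℝ) * (σ - α) := by
      have : 1 / (σ - α) < n := lt_of_lt_of_le (lt_of_le_of_lt (le_max_left _ _) hN) hn'
      rw [div_lt_iff₀ h1] at this
      linarith
    have hB : 1 ≤ (n : ℝ) * (β - σ) := by
      have : 1 / (β - σ) < n := lt_of_lt_of_le (lt_of_le_of_lt (le_max_right _ _) hN) hn'
      rw [div_lt_iff₀ h2] at this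
      linarith
    show (Real.sqrt σ)⁻¹ = kapApprox α β n σ
    unfold kapApprox
    rw [Real.smoothTransition.one_of_one_le hA, Real.smoothTransition.one_of_one_le hB, one_mul,
      psiReg_eq_self hα hσ.1.le, one_div]
  · rw [Set.indicator_of_notMem hσ]
    rw [Set.mem_Ioo, not_and_or, not_lt, not_lt] at hσ
    refine tendsto_const_nhds.congr' (Eventually.of_forall fun n => ?_)
    rcases hσ with h | h
    · exact (kapApprox_eq_zero_of_le n h).symm
    · exact (kapApprox_eq_zero_of_ge n h).symm

/-- ★ **The shell inequality** (Hodge slaving, sphere-free, for `C²` fields): for `W ∈ C²(ℝ³; ℝ³)` tangential about `x₀`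
and unthreaded off `x₀`, and `0 < a < b`,
`∫_{a<|y|<b} |W|²/|y|³ ≤ ½ ∫_{a<|y|<b} (div W)²/|y|`. -/
theorem shell_bochner_ineq {W : E3 → E3} {x₀ : E3} (hW : ContDiff ℝ 2 W) (htan : ∀ z, ⟪W z, z - x₀⟫ = 0)
    (hcurl : ∀ z, z ≠ x₀ → ⟪curl W z, z - x₀⟫ = 0) {a b : ℝ} (ha : 0 < a) (hab : a < b) :
    ∫ x in {x | a < ‖x - x₀‖ ∧ ‖x - x₀‖ < b}, ‖W x‖ ^ 2 / ‖x - x₀‖ ^ 3 ≤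
      (1 / 2) * ∫ x in {x | a < ‖x - x₀‖ ∧ ‖x - x₀‖ < b}, divergence W x ^ 2 / ‖x - x₀‖ := by
  set α : ℝ := a ^ 2 with hα_def
  set β : ℝ := b ^ 2 with hβ_def
  have hb : 0 < b := ha.trans hab
  have hα : 0 < α := by positivity
  set A : Set E3 := {x | a < ‖x - x₀‖ ∧ ‖x - x₀‖ < b} with hA_def
  have hAm : MeasurableSet A := by
    have : A = Metric.ball x₀ b \ Metric.closedBall x₀ a := by
      ext x; simp [hA_def, Metric.mem_closedBall, Metric.mem_ball, dist_eq_norm, and_comm]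
    rw [this]
    exact Metric.isOpen_ball.measurableSet.diff Metric.isClosed_closedBall.measurableSet
  have hmemA : ∀ x : E3, x ∈ A ↔ ‖x - x₀‖ ^ 2 ∈ Set.Ioo α β := by
    intro x
    rw [hA_def, Set.mem_setOf_eq, Set.mem_Ioo, hα_def, hβ_def,
      pow_lt_pow_iff_left₀ ha.le (norm_nonneg _) two_ne_zero, pow_lt_pow_iff_left₀ (norm_nonneg _) hb.le two_ne_zero]
  -- the smooth-weight inequalities
  have hn : ∀ n : ℕ, ∫ x, kapApprox α β n (‖x - x₀‖ ^ 2) * (‖W x‖ ^ 2 / ‖x - x₀‖ ^ 2) ≤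
      (1 / 2) * ∫ x, kapApprox α β n (‖x - x₀‖ ^ 2) * divergence W x ^ 2 := fun n =>
    weighted_bochner_ineq hW htan hcurl (kapApprox_contDiff hα n) hα (fun σ hσ => kapApprox_eq_zero_of_le n hσ)
      (fun σ hσ => kapApprox_eq_zero_of_ge n hσ) (kapApprox_nonneg α β n)
  -- continuity data
  have hWc : Continuous W := hW.continuous
  have hdivWc : Continuous (divergence W) := continuous_divergence (hW.continuous_fderiv (by norm_num))
  have hnsq : Continuous fun x : E3 => ‖x - x₀‖ ^ 2 := (continuous_norm.comp (continuous_id.sub continuous_const)).pow 2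
  have hnc : Continuous fun x : E3 => ‖x - x₀‖ := continuous_norm.comp (continuous_id.sub continuous_const)
  -- compact closed shell carrying everything
  set K : Set E3 := Metric.closedBall x₀ b \ Metric.ball x₀ a with hK_def
  have hK : IsCompact K := (isCompact_closedBall x₀ b).diff Metric.isOpen_ball
  have hKm : MeasurableSet K := Metric.isClosed_closedBall.measurableSet.diff Metric.isOpen_ball.measurableSet
  have hr0 : ∀ x ∈ K, ‖x - x₀‖ ≠ 0 := by
    intro x hx
    simp only [hK_def, Set.mem_sdiff, Metric.mem_ball, dist_eq_norm, not_lt] at hx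
    exact (ha.trans_le hx.2).ne'
  have hzero_off : ∀ (n : ℕ) (x : E3), x ∉ K → kapApprox α β n (‖x - x₀‖ ^ 2) = 0 := by
    intro n x hx
    simp only [hK_def, Set.mem_sdiff, Metric.mem_closedBall, Metric.mem_ball, dist_eq_norm, not_and, not_not] at hx
    by_cases h : ‖x - x₀‖ ≤ b
    · have : ‖x - x₀‖ < a := hx h
      exact kapApprox_eq_zero_of_le n (by rw [hα_def]; exact pow_le_pow_left₀ (norm_nonneg _) this.le 2)
    · exact kapApprox_eq_zero_of_ge n (by rw [hβ_def]; exact pow_le_pow_left₀ hb.le (not_le.1 h).le 2)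
  set C : ℝ := (Real.sqrt (α / 2))⁻¹ with hC_def
  have hC : 0 ≤ C := by positivity
  -- limit of the left-hand sides
  have hL : Tendsto (fun n : ℕ => ∫ x, kapApprox α β n (‖x - x₀‖ ^ 2) * (‖W x‖ ^ 2 / ‖x - x₀‖ ^ 2)) atTop
      (𝓝 (∫ x, A.indicator (fun x => ‖W x‖ ^ 2 / ‖x - x₀‖ ^ 3) x)) := by
    refine tendsto_integral_of_dominated_convergence
      (fun x => K.indicator (fun x => C * (‖W x‖ ^ 2 / ‖x - x₀‖ ^ 2)) x) ?_ ?_ ?_ ?_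
    · intro n
      refine (Continuous.aestronglyMeasurable ?_)
      have hf : ContDiffOn ℝ 0 (fun x => ‖W x‖ ^ 2 / ‖x - x₀‖ ^ 2) {x₀}ᶜ := by
        rw [contDiffOn_zero]
        exact (hWc.norm.pow 2).continuousOn.div (hnc.pow 2).continuousOn fun x hx =>
          pow_ne_zero 2 (norm_ne_zero_iff.2 (sub_ne_zero.2 hx))
      have hg : ContDiff ℝ 0 fun x : E3 => kapApprox α β n (‖x - x₀‖ ^ 2) :=
        ((kapApprox_contDiff hα n).of_le (by norm_num)).comp ((contDiff_id.sub contDiff_const).norm_sq ℝ)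
      exact contDiff_zero.1 (contDiff_smul_of_vanishing (n := 0) (F := ℝ) (Real.sqrt_pos.2 hα) hg
        (fun x hx => radialProfile_eq_zero_of_mem_ball (fun σ hσ => kapApprox_eq_zero_of_le n hσ) hx) hf)
    · refine ((continuousOn_const.mul ((hWc.norm.pow 2).continuousOn.div (hnc.pow 2).continuousOn fun x hx =>
        pow_ne_zero 2 (hr0 x hx))).integrableOn_compact hK).integrable_indicator hKm
    · intro n
      refine Eventually.of_forall fun x => ?_
      by_cases hx : x ∈ K
      · rw [Set.indicator_of_mem hx, Real.norm_eq_abs, abs_mul, abs_of_nonneg (kapApprox_nonneg _ _ _ _),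
          abs_of_nonneg (by positivity)]
        exact mul_le_mul_of_nonneg_right (kapApprox_le hα n _) (by positivity)
      · rw [Set.indicator_of_notMem hx, hzero_off n x hx, zero_mul, norm_zero]
    · refine Eventually.of_forall fun x => ?_
      have h := (tendsto_kapApprox (β := β) hα (‖x - x₀‖ ^ 2)).mul_const (‖W x‖ ^ 2 / ‖x - x₀‖ ^ 2)
      refine h.congr' (Eventually.of_forall fun n => rfl) |>.trans ?_
      by_cases hx : x ∈ A
      · rw [Set.indicator_of_mem hx, Set.indicator_of_mem ((hmemA x).1 hx), Real.sqrt_sq (norm_nonneg _)]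
        have hr : ‖x - x₀‖ ≠ 0 := (ha.trans hx.1).ne'
        rw [show ‖W x‖ ^ 2 / ‖x - x₀‖ ^ 3 = (‖x - x₀‖)⁻¹ * (‖W x‖ ^ 2 / ‖x - x₀‖ ^ 2) by field_simp]
      · have hx' : ‖x - x₀‖ ^ 2 ∉ Set.Ioo α β := fun h => hx ((hmemA x).2 h)
        rw [Set.indicator_of_notMem hx, Set.indicator_of_notMem hx', zero_mul]
  -- limit of the right-hand sides
  have hR : Tendsto (fun n : ℕ => (1 / 2) * ∫ x, kapApprox α β n (‖x - x₀‖ ^ 2) * divergence W x ^ 2) atTop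
      (𝓝 ((1 / 2) * ∫ x, A.indicator (fun x => divergence W x ^ 2 / ‖x - x₀‖) x)) := by
    refine (tendsto_integral_of_dominated_convergence
      (fun x => K.indicator (fun x => C * divergence W x ^ 2) x) ?_ ?_ ?_ ?_).const_mul (1 / 2)
    · intro n
      exact ((((kapApprox_contDiff hα n).continuous).comp hnsq).mul (hdivWc.pow 2)).aestronglyMeasurable
    · exact ((continuous_const.mul (hdivWc.pow 2)).continuousOn.integrableOn_compact hK).integrable_indicator hKm
    · intro n
      refine Eventually.of_forall fun x => ?_
      by_cases hx : x ∈ K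
      · rw [Set.indicator_of_mem hx, Real.norm_eq_abs, abs_mul, abs_of_nonneg (kapApprox_nonneg _ _ _ _),
          abs_of_nonneg (sq_nonneg _)]
        exact mul_le_mul_of_nonneg_right (kapApprox_le hα n _) (sq_nonneg _)
      · rw [Set.indicator_of_notMem hx, hzero_off n x hx, zero_mul, norm_zero]
    · refine Eventually.of_forall fun x => ?_
      have h := (tendsto_kapApprox (β := β) hα (‖x - x₀‖ ^ 2)).mul_const (divergence W x ^ 2)
      refine h.congr' (Eventually.of_forall fun n => rfl) |>.trans ?_
      by_cases hx : x ∈ A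
      · rw [Set.indicator_of_mem hx, Set.indicator_of_mem ((hmemA x).1 hx), Real.sqrt_sq (norm_nonneg _)]
        have hr : ‖x - x₀‖ ≠ 0 := (ha.trans hx.1).ne'
        rw [show divergence W x ^ 2 / ‖x - x₀‖ = (‖x - x₀‖)⁻¹ * divergence W x ^ 2 by field_simp]
      · have hx' : ‖x - x₀‖ ^ 2 ∉ Set.Ioo α β := fun h => hx ((hmemA x).2 h)
        rw [Set.indicator_of_notMem hx, Set.indicator_of_notMem hx', zero_mul]
  have hle := le_of_tendsto_of_tendsto' hL hR hn
  rw [integral_indicator hAm, integral_indicator hAm] at hle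
  exact hle


end Hodge

end Summit.NavierStokesRegularity.NavierStokesRegularity.Theorems.PoloidalLiouville.CentreVirial
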